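import Mathlib
import Summits.PneNP.PneNP.Theorems.CnfIdealGenLengthRankDefectRepresentationsSimReduction

/-!
# Crux `RankDefectRepresentations` (stmt-PneNP-18923), line `rank-dehn-ladder`: the SIM gluing constant is AT LEAST LINEAR
# (lead g17; first lower bound for `SimBound` beyond `O(1)`, cf. memo `Lines/rank-dehn-ladder-g8.md` §6 "no lower bound for SIM beyond
# `O(1)` is known" and `Lines/rank-dehn-ladder-g16.md` §8 (2a) "polynomial SIM")

`SimBound K κ C` (`Theorems/…SimReduction`, p652532): every family `y_k` supported on the `k`-cuts and pairwise consistent on overlaps up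
to rank `t` is glued by ONE matrix `z` with `rank (cut k (z − y_k)) ≤ C·t` for every `k`.  Known after lead g16: `C_n ≤ n^{O(log n)}`
(`…SimQuasiPoly.simBound_quasiPoly`, unconditional).

THIS FILE: **`SimBound K (Fin n) C → n ≤ 2C + 1`**, i.e. `C_n ≥ (n − 1)/2` (`simBound_linear_lower`).  The witness is ONE-SIDED (every row
has the all-`false` colour, so the `k`-cut of a matrix is just its set of columns whose colour contains `k`): one column and one row per pair
`l < k` of coordinates, the column coloured `{k, l}`; `y_k` = the diagonal indicator of the pairs whose larger element is `k`, `t = 1`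
(the `(k,l)` double cut is the single column `(k,l)`, where `y_k − y_l` is a unit vector).  For any glued `z` the column `(k,l)` of
`cut l (z − y_l)` minus the column `(k,l)` of `cut k (z − y_k)` is the unit vector `e_{(k,l)}`, so the column spaces of the `n` error matrices
together span the whole `n(n−1)/2`-dimensional space, while each has dimension `≤ C`: `n(n−1)/2 ≤ n·C`.
So in its own currency (max over `k`, units of the largest pairwise defect) SIM is at best LINEARLY stable; "polynomial SIM" means an exponent
`≥ 1`.  (Remark, not formalised here: for one-sided instances the selection rule `z := y_{min Diff}` achieves `C = n − 1`, and in the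
SUM currency `Σ_k rank (cut k (z − y_k)) ≤ Σ_{k<l} rank (cut k cut l (y_k − y_l))` it achieves the constant `1`; the witness below is tight for
that inequality.)
HONEST FRAMING: a calibration of the depth-2 tool lane of N0b; it does not touch the item (RDR); P ≠ NP is not moved; F-N2 is a FRONTIER
formal rung.
-/

set_option linter.dupNamespace false -- `Summit.PneNP.PneNP.…`: summit = sub-problem name (D-0017)

namespace Summit.PneNP.PneNP.Theorems.CnfIdealGenLengthRankDefectRepresentationsSimLowerBound

open Matrix
open Summit.PneNP.PneNP.Theorems.CnfIdealGenLengthRankDefectRepresentationsSimReduction (cut SimBound)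

variable {K : Type} [Field K]

/-- A matrix supported in a single column has rank at most one. -/
theorem rank_le_one_of_single_col {ι ι' : Type} [Fintype ι] [Fintype ι'] [DecidableEq ι'] (M : Matrix ι ι' K) (p : ι')
    (h : ∀ x y, y ≠ p → M x y = 0) : M.rank ≤ 1 := by
  have hM : M = vecMulVec (fun x => M x p) (Pi.single p 1) := by
    ext x y
    by_cases hy : y = p
    · subst hy; simp [vecMulVec_apply]
    · simp [vecMulVec_apply, hy, h x y hy]
  rw [hM]; exact rank_vecMulVec_le _ _

/-- The `p`-th column of `M` lies in the range of `M.mulVecLin` (it is `M e_p`). -/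
theorem col_mem_range {ι ι' : Type} [Fintype ι] [Fintype ι'] [DecidableEq ι'] (M : Matrix ι ι' K) (p : ι') :
    (fun x => M x p) ∈ LinearMap.range M.mulVecLin := by
  refine ⟨Pi.single p 1, ?_⟩
  rw [Matrix.mulVecLin_apply, Matrix.mulVec_single_one]; rfl

/-- The dimension of a finite supremum of column spaces is at most the sum of the ranks. -/
theorem finrank_sup_range_le {ι ι' α : Type} [Fintype ι] [Fintype ι'] [DecidableEq ι'] [DecidableEq α]
    (f : α → Matrix ι ι' K) (s : Finset α) :
    Module.finrank K ↥(s.sup fun k => LinearMap.range (f k).mulVecLin) ≤ ∑ k ∈ s, (f k).rank := by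
  classical
  induction s using Finset.induction_on with
  | empty => simp
  | insert a s ha ih =>
    rw [Finset.sup_insert, Finset.sum_insert ha]
    exact (Submodule.finrank_add_le_finrank_add_finrank _ _).trans (Nat.add_le_add le_rfl ih)

/-- The index type of the witness: pairs `l < k` of coordinates, as `⟨k, l⟩` with `l : Fin k`. -/
abbrev Pair (n : ℕ) : Type := (k : Fin n) × Fin k

/-- The number of pairs is `n(n−1)/2`, in the division-free form `2 · #pairs = n(n−1)`. -/
theorem card_pair_mul_two (n : ℕ) : Fintype.card (Pair n) * 2 = n * (n - 1) := by
  rw [Fintype.card_sigma]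
  simp only [Fintype.card_fin]
  rw [Fin.sum_univ_eq_sum_range (fun i => i) n, Finset.sum_range_id_mul_two]

/-- Column colouring of the witness: the column `⟨k, l⟩` has colour `{k, l}`. -/
def colW (n : ℕ) (p : Pair n) (m : Fin n) : Bool := decide (m = p.1 ∨ m.val = p.2.val)

/-- Row colouring of the witness: every row is coloured all-`false`. -/
def rowW (n : ℕ) (_ : Pair n) (_ : Fin n) : Bool := false

/-- Data of the witness: `y_k` is the diagonal indicator of the pairs `⟨k, l⟩` (larger element `k`). -/
def yW (n : ℕ) (k : Fin n) : Matrix (Pair n) (Pair n) K := Matrix.of fun x y => if x = y ∧ y.1 = k then 1 else 0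

/-- With all-`false` rows, the `m`-cut keeps exactly the columns whose colour contains `m`. -/
theorem cutW_apply (n : ℕ) (m : Fin n) (M : Matrix (Pair n) (Pair n) K) (x : Pair n) (y1 : Fin n) (y2 : Fin y1) :
    cut (rowW n) (colW n) m M x ⟨y1, y2⟩ = if (m = y1 ∨ m.val = y2.val) then M x ⟨y1, y2⟩ else 0 := by
  simp only [cut, rowW, colW, Matrix.of_apply]
  by_cases h : (m = y1 ∨ m.val = y2.val) <;> simp [h]

/-- The data are supported on their cuts. -/
theorem yW_supp (n : ℕ) (k : Fin n) : cut (rowW n) (colW n) k (yW (K := K) n k) = yW n k := by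
  ext x ⟨y1, y2⟩
  rw [cutW_apply]
  by_cases h : (k = y1 ∨ k.val = y2.val)
  · rw [if_pos h]
  · rw [if_neg h, yW, Matrix.of_apply, if_neg]
    rintro ⟨-, h'⟩
    exact h (Or.inl h'.symm)

/-- Off the column `⟨k, l⟩`, the entries of `y_k − y_l` vanish wherever both `k` and `l` belong to the column's colour. -/
theorem yW_sub_apply_eq_zero (n : ℕ) (k l : Fin n) (hlk : l < k) (x : Pair n) (y1 : Fin n) (y2 : Fin y1)
    (hy : (⟨y1, y2⟩ : Pair n) ≠ ⟨k, ⟨l.val, hlk⟩⟩) (hk : k = y1 ∨ k.val = y2.val) (hl : l = y1 ∨ l.val = y2.val) :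
    ((yW n k - yW n l : Matrix (Pair n) (Pair n) K)) x ⟨y1, y2⟩ = 0 := by
  have hy2 : y2.val < y1.val := y2.isLt
  have hlk' : l.val < k.val := hlk
  have hk' : ¬ (x = ⟨y1, y2⟩ ∧ y1 = k) := by
    rintro ⟨-, rfl⟩
    rcases hl with hl | hl
    · exact absurd hl (ne_of_lt hlk)
    · exact hy (Sigma.ext rfl (heq_of_eq (Fin.ext hl.symm)))
  have hl' : ¬ (x = ⟨y1, y2⟩ ∧ y1 = l) := by
    rintro ⟨-, rfl⟩
    rcases hk with hk | hk
    · exact absurd hk.symm (ne_of_lt hlk)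
    · omega
  simp only [Matrix.sub_apply, yW, Matrix.of_apply]
  rw [if_neg hk', if_neg hl', sub_zero]

/-- The pairwise defects of the witness have rank `≤ 1` (the `(k,l)` double cut is the single column `⟨k,l⟩`). -/
theorem yW_cons (n : ℕ) (k l : Fin n) :
    (cut (rowW n) (colW n) k (cut (rowW n) (colW n) l (yW (K := K) n k - yW n l))).rank ≤ 1 := by
  classical
  rcases lt_trichotomy l k with hlk | rfl | hkl
  · refine rank_le_one_of_single_col _ ⟨k, ⟨l.val, hlk⟩⟩ ?_
    rintro x ⟨y1, y2⟩ hy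
    rw [cutW_apply, cutW_apply]
    by_cases hk : (k = y1 ∨ k.val = y2.val)
    · by_cases hl : (l = y1 ∨ l.val = y2.val)
      · rw [if_pos hk, if_pos hl]; exact yW_sub_apply_eq_zero n k l hlk x y1 y2 hy hk hl
      · rw [if_pos hk, if_neg hl]
    · rw [if_neg hk]
  · have h0 : ∀ m, cut (rowW n) (colW n) m (0 : Matrix (Pair n) (Pair n) K) = 0 := by
      intro m; ext x ⟨y1, y2⟩; rw [cutW_apply]; simp
    rw [sub_self, h0, h0, Matrix.rank_zero]; exact Nat.zero_le _
  · refine rank_le_one_of_single_col _ ⟨l, ⟨k.val, hkl⟩⟩ ?_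
    rintro x ⟨y1, y2⟩ hy
    rw [cutW_apply, cutW_apply]
    by_cases hk : (k = y1 ∨ k.val = y2.val)
    · by_cases hl : (l = y1 ∨ l.val = y2.val)
      · rw [if_pos hk, if_pos hl]
        have e : ((yW n k - yW n l : Matrix (Pair n) (Pair n) K)) x ⟨y1, y2⟩ = -(((yW n l - yW n k : Matrix (Pair n) (Pair n) K)) x ⟨y1, y2⟩) := by
          simp only [Matrix.sub_apply, neg_sub]
        rw [e, yW_sub_apply_eq_zero n l k hkl x y1 y2 hy hl hk, neg_zero]
      · rw [if_pos hk, if_neg hl]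
    · rw [if_neg hk]

/-- **SIM IS AT BEST LINEARLY STABLE** (lead g17): `SimBound K (Fin n) C → n ≤ 2C + 1`, i.e. the SIM gluing constant is `≥ (n−1)/2`.
First lower bound for the depth-2 core of N0b beyond `O(1)`; the upper bound in the tree is `n^{O(log n)}` (`simBound_quasiPoly`). -/
theorem simBound_linear_lower (K : Type) [Field K] (n C : ℕ)
    (h : Summit.PneNP.PneNP.Theorems.CnfIdealGenLengthRankDefectRepresentationsSimReduction.SimBound K (Fin n) C) :
    n ≤ 2 * C + 1 := by
  classical
  obtain ⟨z, hz⟩ := h (Pair n) (Pair n) (rowW n) (colW n) (yW n) 1 (yW_supp n) (yW_cons n)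
  -- the error matrices and the span of their column spaces
  set U : Submodule K (Pair n → K) :=
    Finset.univ.sup fun k => LinearMap.range (cut (rowW n) (colW n) k (z - yW n k)).mulVecLin with hU
  -- every unit vector lies in `U`
  have hunit : ∀ p : Pair n, (Pi.single p (1 : K) : Pair n → K) ∈ U := by
    rintro ⟨k, l⟩
    obtain ⟨l', hl'⟩ : ∃ l' : Fin n, l'.val = l.val := ⟨⟨l.val, lt_trans l.isLt k.isLt⟩, rfl⟩
    have hkl : l' ≠ k := by
      intro h; have h' := congrArg Fin.val h; have := l.isLt; omega
    -- column `⟨k,l⟩` of the `l'`-error is the column of `z`; that of the `k`-error is the column of `z` minus `e_{⟨k,l⟩}`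
    have e1 : ∀ x, cut (rowW n) (colW n) l' (z - yW n l') x ⟨k, l⟩ = z x ⟨k, l⟩ := by
      intro x
      rw [cutW_apply, if_pos (Or.inr hl'), Matrix.sub_apply, yW, Matrix.of_apply, if_neg (fun h => hkl h.2.symm), sub_zero]
    have e2 : ∀ x, cut (rowW n) (colW n) k (z - yW n k) x ⟨k, l⟩ = z x ⟨k, l⟩ - (Pi.single (⟨k, l⟩ : Pair n) (1 : K) : Pair n → K) x := by
      intro x
      rw [cutW_apply, if_pos (Or.inl rfl), Matrix.sub_apply, yW, Matrix.of_apply, Pi.single_apply]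
      congr 1
      by_cases hx : x = ⟨k, l⟩ <;> simp [hx]
    have hcol : (fun x => cut (rowW n) (colW n) l' (z - yW n l') x ⟨k, l⟩) -
        (fun x => cut (rowW n) (colW n) k (z - yW n k) x ⟨k, l⟩) = Pi.single (⟨k, l⟩ : Pair n) (1 : K) := by
      ext x
      rw [Pi.sub_apply, e1, e2, sub_sub_cancel]
    rw [← hcol]
    refine Submodule.sub_mem _ ?_ ?_
    · exact SetLike.le_def.mp (Finset.le_sup (f := fun k => LinearMap.range (cut (rowW n) (colW n) k (z - yW n k)).mulVecLin)
        (Finset.mem_univ l')) (col_mem_range _ _)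
    · exact SetLike.le_def.mp (Finset.le_sup (f := fun k => LinearMap.range (cut (rowW n) (colW n) k (z - yW n k)).mulVecLin)
        (Finset.mem_univ k)) (col_mem_range _ _)
  have htop : U = ⊤ := by
    rw [eq_top_iff, ← (Pi.basisFun K (Pair n)).span_eq, Submodule.span_le]
    rintro v ⟨p, rfl⟩
    simpa [Pi.basisFun_apply] using hunit p
  -- dimension count: `#pairs = dim U ≤ Σ_k rank ≤ n·C`
  have hdim : Fintype.card (Pair n) ≤ n * C := by
    have h1 : Module.finrank K ↥U = Fintype.card (Pair n) := by
      rw [htop, finrank_top, Module.finrank_fintype_fun_eq_card]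
    have h2 : Module.finrank K ↥U ≤ ∑ k : Fin n, (cut (rowW n) (colW n) k (z - yW n k)).rank :=
      finrank_sup_range_le (fun k => cut (rowW n) (colW n) k (z - yW n k)) Finset.univ
    have h3 : ∑ k : Fin n, (cut (rowW n) (colW n) k (z - yW n k)).rank ≤ ∑ _k : Fin n, C :=
      Finset.sum_le_sum fun k _ => by simpa using hz k
    rw [Finset.sum_const, Finset.card_univ, Fintype.card_fin, smul_eq_mul] at h3
    omega
  -- `n(n−1) = 2·#pairs ≤ 2nC` gives `n ≤ 2C + 1`
  have h2 := card_pair_mul_two n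
  rcases Nat.eq_zero_or_pos n with hn | hn
  · omega
  · have hle : n * (n - 1) ≤ n * (2 * C) := by
      calc n * (n - 1) = Fintype.card (Pair n) * 2 := h2.symm
        _ ≤ n * C * 2 := Nat.mul_le_mul_right 2 hdim
        _ = n * (2 * C) := by ring
    have := Nat.le_of_mul_le_mul_left hle hn
    omega

end Summit.PneNP.PneNP.Theorems.CnfIdealGenLengthRankDefectRepresentationsSimLowerBound
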